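import Literature.NumberTheory.Transcendental.BrownMotivicOrbitGenerators
import HarnessLib

/-!
# The Deligne–Goncharov input of Brown's motivic MZV package, as ONE hypothesis bundle

Topic `Literature/NumberTheory/Transcendental` (joins the story `BrownMotivicGaloisData.lean`, …,
`BrownMotivicOrbitGenerators.lean`, whose vocabulary it uses: `UAlg = 𝒰`, `ρgen`, `iharaLaw`,
`dch`, `WordSeries.delta`, `WordSeries.tensor`).

The files `BrownMotivicGaloisData.lean` … `BrownMotivicOrbitGenerators.lean` formalize
[Brown2012, §§2.1–2.5, §3.1, Thm 2.4], Goncharov's Hopf-algebra combinatorics [Goncharov2005,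
Thm 1.2], Ihara's group law [DG05, 5.11–5.12] and the freeness of `Lie G_𝒰` made constructive
(`ρgen`), ending in `Brown2012.motivicMZV_nonempty_of_lieGenerators`: Brown's package
`Brown2012.MotivicMZV` — hence the named fact `Brown2012.motivicMZV_nonempty`
(`BrownMotivicMZVExistence.lean`), Hoffman's theorem and `dim 𝒵_N ≤ d_N` — follows from ten
first-order hypotheses about the Drinfeld associator.  This file bundles those ten hypotheses into
ONE structure, `DeligneGoncharov2005.MotivicOrbitWitness` (a hypothesis bundle like `MotivicMZV`
and `MotivicGaloisData`; no named fact is introduced), records precisely which printed theorem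
asserts that it is inhabited, and CONSTRUCTS Brown's package from a witness as data
(`MotivicOrbitWitness.toMotivicMZV`), so that the single remaining input of the formalization of
[Brown2012] reads, in one line,

  `Nonempty DeligneGoncharov2005.MotivicOrbitWitness`  (`⟹ Brown2012.motivicMZV_nonempty`,
  `motivicMZV_nonempty_of_nonempty_motivicOrbitWitness`).

## The theorem that inhabits the bundle [DG05 + Borel; Brown §2.1, §2.3, §2.5]

Let `₀Π₁` be the scheme of group-like series in `e₀, e₁` (`𝒪(₀Π₁) = ℚ⟨e⁰, e¹⟩` with the shuffle
product, [Brown2012, (2.1)]; [DG05, 5.8]) with Ihara's group law `∘` ([DG05, Prop. 5.11, 5.12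
(5.12.1)]: `a ∘ b = a·⟨a⟩₀(b)`), and let `dch ∈ ₀Π₁(ℝ)` be the Drinfeld associator ([Brown2012,
(2.2)]; [DG05, 5.16]).  The motivic Galois group of `MT(ℤ)` (de Rham fibre functor) is
`G = G_𝒰 ⋊ 𝔾_m` with `G_𝒰` pro-unipotent and **`Lie G_𝒰` graded FREE on one generator `σ_{2i+1}`
in every degree `-2i-1`, `i ≥ 1`** — [DG05, (2.1.2), (2.1.3), Prop. 2.2, Prop. 2.3] (`Lie G_𝒰` is
free on `⊕_n Ext¹_{MT(ℤ)}(ℚ(0), ℚ(n))^∨`, and `Ext¹_{MT(ℤ)}(ℚ(0), ℚ(n)) = K_{2n-1}(ℤ) ⊗ ℚ`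
([DG05, 1.6]) has dimension `1` for `n ≥ 3` odd and `0` otherwise, by Borel's ranks
[Borel1974, §12]); [Brown2012, §2.5, (2.20)–(2.22)].  `G` acts on `₀Π₁` ([Brown2012, (2.3)];
[DG05, 5.8, (5.10.3), (5.15.1)]) through a homomorphism of group schemes `G_𝒰 → (₀Π₁, ∘)`,
`g ↦ g·₀1₁` ([DG05, (5.10.3), Prop. 5.11 (`V_ω ≅ Π`), 5.12]; [Brown2012, (2.4), (2.6)]), whose
differential sends `σ_{2i+1}` to homogeneous elements of weight `2i+1` of
`Lie(₀Π₁, ∘) = Lie⟨⟨e₀, e₁⟩⟩`, i.e. to homogeneous LIE (= primitive) polynomials, still denoted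
`σ_{2i+1}`, acting on series by the infinitesimal Ihara action `s_σ(x) = x σ + D_σ(x)`
([DG05, (5.11.4), (5.11.5), (5.12.1)]).  Conversely, BY FREENESS, any such family `σ` defines a
homomorphism `G_𝒰 → (₀Π₁, ∘)` whose orbit map of the unit path is the graded shuffle character
`ρgen σ : 𝒪(₀Π₁) → 𝒰'` of `BrownMotivicOrbitGenerators.lean`, PROVED there to be
Ihara-homomorphic at all points (`ρgen_pointHom`).  Finally:

* `dch = g τ(√t₀).γ` for an EVEN RATIONAL point `γ ∈ ₀Π₁(ℚ)` and a REAL point `(g, t₀)` of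
  `G_𝒰 × 𝔸¹` — [Brown2012, §2.3: "choose a rational point `γ ∈ 𝒵(ℚ)` which is even (see [DG],
  5.20) … we obtain an isomorphism `G'_𝒰 × 𝔸¹ ≅ 𝒵`, `(g, t) ↦ g τ(√t).γ`" (2.12), with
  `dch ∈ 𝒵(ℝ)`, `𝒵 = Spec H` the orbit closure, defined over `ℚ` "since `dch` is
  Betti-rational"]; [DG05, Prop. 5.18, 5.19 (5.19.1)–(5.19.2): `dch(σ) ∈ ι(U_ω) ∘ D_σ`,
  `v_σ ∈ V_ω(ℚ)`; 5.20: `a_σ⁰` real, `log v_σ` purely of even degree; Thm. 5.24].  Here `τ` is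
  the action of `𝔾_m` (`τ(λ)` multiplies degree `d` by `λ^d`), so `τ(√t₀).γ` has coordinates
  `w ↦ γ(w) t₀^{|w|/2}` (`γ` even), and a real point of Brown's quotient `G'_𝒰` lifts to `G_𝒰`
  (a quotient map of pro-unipotent groups; or directly `a_σ⁰ ∈ U_ω(ℝ)`, [DG05, 2.12, 5.20]).

## The bundle in the tree's coordinates

`MotivicOrbitWitness` = (`σ : ℕ → WordSeries Bool ℚ` with `σ n` supported on words of length `n`,
zero unless `n` is odd `> 1`, and primitive for the deshuffle coproduct `δ` of `ℚ⟨e₀, e₁⟩` — the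
primitive elements being the Lie polynomials, Friedrichs' criterion [Reutenauer1993, Thm 1.4]) ×
(an even rational shuffle character `γ`) × (a ring homomorphism `a : 𝒰 → ℝ`, i.e. a real point of
`G_𝒰 = Spec 𝒰'` extended by `f₂ ↦` anything) × (`t₀ : ℝ`) × (the orbit identity
`dch = (a ∘ ρgen σ) ⋆ (w ↦ γ(w) t₀^{|w|/2})` for the tree's `Brown2012.dch` and `iharaLaw`).
Conventions absorbed by the data (so that `Nonempty MotivicOrbitWitness` is exactly as strong as
the printed theorem): the generators `σ_{2i+1}` are not canonical ([Brown2012, §2.5 and §3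
Remark]; [DG05, 2.4 "Mise en garde"]); Brown's orientation of words and sign of `ω₁` differ from
[DG05]'s ([Brown2012, §2.4; Thm 2.4 "with the factors interchanged"]) by `e₁ ↦ -e₁` composed with
word reversal, which carries [DG05]'s `(Π, ∘)` to the tree's `(₀Π₁, iharaLaw)`, Lie polynomials to
Lie polynomials, and [DG05]'s `dch(σ)` to `Brown2012.dch` (`BrownIharaCoaction.lean`,
`BrownMotivicPeriodPoint.lean`).

## Why `Nonempty MotivicOrbitWitness` is not proved here

It is the existence and structure of the Tannakian category `MT(ℤ)` (Levine, Voevodsky;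
[DG05, §1]), Borel's computation of `K_{2n-1}(ℤ) ⊗ ℚ`, and the motivic fundamental groupoid of
`ℙ¹ ∖ {0,1,∞}` with tangential base points and its Betti–de Rham comparison ([DG05, §§3–5]) —
none of which exists in Mathlib or `Literature/`; and no cheaper road exists: any witness yields
(`finrank_mzvSpace_le_zagierDim_of_motivicOrbitWitness`) the bound `dim_ℚ 𝒵_N ≤ d_N` for REAL
multiple zeta values, all of whose published proofs (Terasoma, Deligne–Goncharov, Brown) are
motivic.

## References

* P. Deligne, A. B. Goncharov, *Groupes fondamentaux motiviques de Tate mixte*, Ann. Sci. ÉNS 38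
  (2005) 1–56; arXiv:math/0302267: 1.6, (2.1.2)–(2.1.3), Prop. 2.2, Prop. 2.3, 2.4, 2.12, 5.8,
  (5.10.3), Prop. 5.11, 5.12, Remark 5.15, 5.16, Prop. 5.17–5.18, 5.19, 5.20, Thm. 5.24, Cor. 5.25.
  [DeligneGoncharov2005]
* F. Brown, *Mixed Tate motives over ℤ*, Ann. of Math. 175 (2012) 949–976; arXiv:1102.1312: §2.1
  (2.1)–(2.6), §2.3 (2.12), §2.5 (2.20)–(2.22), §3.1. [BrownMTM2012]
* A. Borel, *Stable real cohomology of arithmetic groups*, Ann. Sci. ÉNS 7 (1974) 235–272, §12.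
  [Borel1974]
* A. B. Goncharov, *Galois symmetries of fundamental groupoids and noncommutative geometry*, Duke
  Math. J. 128 (2005), Thm 1.2. [Goncharov2005]
* C. Reutenauer, *Free Lie algebras*, Oxford 1993, Thm 1.4 (Friedrichs' criterion).
  [Reutenauer1993]
-/

noncomputable section

namespace Literature.NumberTheory.Transcendental

namespace DeligneGoncharov2005

open MZV ShuffleMonoidAlgebra Brown2012
open GoncharovFormalIteratedIntegrals (WordSeries iharaMul IsWt)
open GoncharovFormalIteratedIntegrals.WordSeries (delta tensor)

/-- **The Deligne–Goncharov input of Brown's §2 as one hypothesis bundle** (module docstring):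
homogeneous rational Lie polynomials `σ_n ∈ ℚ⟨e₀, e₁⟩` (zero unless `n` odd `> 1`) — the images
of free generators of `Lie G_𝒰` [DG05, 1.6, (2.1.2)–(2.1.3), Prop. 2.2–2.3; Borel1974, §12;
Brown2012, §2.5] acting by the infinitesimal Ihara action [DG05, (5.10.3), Prop. 5.11, 5.12,
(5.15.1)] —, an even rational point `γ ∈ ₀Π₁(ℚ)`, a real point `(a, t₀)` of `G_𝒰 × 𝔸¹`, and the
orbit identity `dch = (a·₀1₁) ∘ τ(√t₀).γ` [Brown2012, §2.3 (2.12)]; [DG05, 5.16, (5.19.2), 5.20,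
Thm. 5.24].  No named fact: the printed theorem is `Nonempty MotivicOrbitWitness`.
[cite: DeligneGoncharov2005, 1.6, (2.1.2)–(2.1.3), Prop. 2.2–2.3, (5.10.3), Prop. 5.11, 5.12
(5.12.1), (5.15.1), 5.16, 5.19 (5.19.2), 5.20, Thm. 5.24; BrownMTM2012, §2.1 (2.1)–(2.6), §2.3
(2.12), §2.5 (2.20)–(2.22); Borel1974, §12] -/
structure MotivicOrbitWitness where
  /-- The generators `σ_n ∈ ℚ⟨e₀, e₁⟩` (images of free generators of `Lie G_𝒰`). -/
  σ : ℕ → WordSeries Bool ℚ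
  /-- `σ_n` is homogeneous of weight `n`, and zero unless `n` is odd `> 1` (Borel). -/
  σ_wt : ∀ (n : ℕ) (w : List Bool), σ n w ≠ 0 → w.length = n ∧ Odd n ∧ 1 < n
  /-- `σ_n` is primitive for the deshuffle coproduct (a Lie polynomial). -/
  σ_prim : ∀ n : ℕ, delta (σ n) = tensor (σ n) 1 + tensor 1 (σ n)
  /-- The rational point `γ ∈ ₀Π₁(ℚ)` (coordinates). -/
  γ : List Bool → ℚ
  /-- `γ` is a point: unital … -/
  γ_nil : γ [] = 1
  /-- … shuffle character. -/
  γ_mul : ∀ u v : List Bool, γ u * γ v = ((shuffleWord u v).map γ).sum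
  /-- `γ` is even (`τ(-1)γ = γ`). -/
  γ_odd : ∀ w : List Bool, Odd w.length → γ w = 0
  /-- A real point of `G_𝒰 = Spec 𝒰'` (extended to `𝒰` anyhow). -/
  a : UAlg →+* ℝ
  /-- The `𝔸¹`-coordinate (`= ζ(2)/γ(e₁e₀)` a posteriori). -/
  t₀ : ℝ
  /-- The orbit identity `dch = (a·₀1₁) ∘ τ(√t₀).γ` [Brown2012, (2.12)]. -/
  orbit : ∀ w : List Bool,
    dch w = iharaLaw (fun v => a (ρgen σ v)) (fun v => (γ v : ℝ) * t₀ ^ (v.length / 2)) w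

namespace MotivicOrbitWitness

variable (W : MotivicOrbitWitness)

/-- `σ_n` is homogeneous of weight `n`. [cite: BrownMTM2012, §2.5] -/
theorem isWt (n : ℕ) : IsWt (W.σ n) n := fun w h => (W.σ_wt n w h).1

/-- Non-zero generators sit in odd weights `> 1`. [cite: BrownMTM2012, §2.5; Borel1974, §12] -/
theorem odd_of_ne_zero (n : ℕ) (h : W.σ n ≠ 0) : Odd n ∧ 1 < n := by
  obtain ⟨w, hw⟩ := Function.ne_iff.1 h
  exact (W.σ_wt n w hw).2

/-- The orbit map of the unit path, `ρ = ρgen σ : 𝒪(₀Π₁) → 𝒰'` ([Brown2012, (2.4), (2.6)]).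
[cite: BrownMTM2012, §2.1 (2.4)–(2.6), §2.5] -/
abbrev ρ : List Bool → UAlg := ρgen W.σ

/-- `ρ(∅) = 1`. [cite: BrownMTM2012, §2.1 (2.6)] -/
theorem ρ_nil : W.ρ [] = 1 := ρgen_nil W.σ

/-- `ρ` is a shuffle character. [cite: BrownMTM2012, §2.1 (2.6)] -/
theorem ρ_mul (u v : List Bool) : W.ρ u * W.ρ v = ((shuffleWord u v).map W.ρ).sum :=
  ρgen_mul W.isWt W.σ_prim u v

/-- `ρ` is graded with values in `𝒰'`. [cite: BrownMTM2012, (2.20)–(2.22)] -/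
theorem ρ_mem (w : List Bool) : W.ρ w ∈ uPrime w.length := ρgen_mem W.isWt W.odd_of_ne_zero w

/-- The orbit map is a homomorphism `G_𝒰(B) → (₀Π₁(B), ⋆)` at all points.
[cite: DeligneGoncharov2005, (5.10.3), Prop. 5.11, (5.12.1), (5.15.1)] -/
theorem ρ_pointHom {B : Type} [CommRing B] [Algebra ℚ B] (g h : UAlg →+* B) (w : List Bool) :
    pointMul g h (W.ρ w) = iharaLaw (fun v => g (W.ρ v)) (fun v => h (W.ρ v)) w :=
  ρgen_pointHom W.isWt W.σ_prim g h w

/-- The orbit map is Ihara-homomorphic at the universal pair of points (`ρ_hom`).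
[cite: DeligneGoncharov2005, (5.10.3), (5.12.1), (5.15.1)] -/
theorem ρ_hom (w : List Bool) : decHom (W.ρ w) = iharaMul (orbitFamilyL W.ρ) (orbitR W.ρ) w :=
  ρ_hom_of_pointHom W.ρ (fun _ _ _ g h w => W.ρ_pointHom g h w) w

/-- The orbit identity in Brown's form (2.12)/(2.13): `per ∘ Ψ = dch` for the period functional
of the real point `(a, t₀)`. [cite: BrownMTM2012, §2.3 (2.12)–(2.13)] -/
theorem comparison (w : List Bool) : perLin (fun b => W.a (e 0 b)) W.t₀ (Ψ W.ρ W.γ w) = dch w := by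
  rw [perLin_Ψ_eq_iharaLaw _ W.t₀ W.ρ W.ρ_nil W.ρ_mul (table_nil W.a) (table_mul W.a), W.orbit w]
  congr 1
  funext v
  exact perLin_eq_of_mem_uPrime W.a W.t₀ (W.ρ_mem v)

/-- **Brown's coaction data from a witness** (`MotivicGaloisData.ofIharaComparison`).
[cite: BrownMTM2012, §2.1 (2.3)–(2.6), §2.3 (2.12), Theorem 2.4] -/
def toGaloisData : MotivicGaloisData :=
  MotivicGaloisData.ofIharaComparison W.ρ W.ρ_nil W.ρ_mul W.ρ_mem W.ρ_hom W.γ W.γ_nil W.γ_mul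
    W.γ_odd (fun b => W.a (e 0 b)) (table_nil W.a) (table_mul W.a) W.t₀ W.comparison

/-- The coaction data of a witness has orbit map `ρgen σ`. [cite: BrownMTM2012, §2.1 (2.6)] -/
@[simp] theorem toGaloisData_ρ : W.toGaloisData.ρ = W.ρ := rfl

/-- **Brown's motivic MZV package CONSTRUCTED from a witness**: `H ⊆ 𝒰`, `ζᵐ`, `per`, `φ`,
`∂ʰ_{2r+1}`, (3.4), (3.8) ([Brown2012, §§2.1–2.5, §3.1] as theorems of the tree).
[cite: BrownMTM2012, §2 (Def. 2.1, (2.11)–(2.22), Thm 2.4) and §3.1 (Def. 3.1, (3.1)–(3.4),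
(3.8))] -/
def toMotivicMZV : MotivicMZV := W.toGaloisData.toMotivicMZV

end MotivicOrbitWitness

end DeligneGoncharov2005

namespace Brown2012

/-- **Brown's package exists, given a Deligne–Goncharov witness.**
[cite: BrownMTM2012, §§2.1–2.5, §3.1] -/
theorem motivicMZV_nonempty_of_motivicOrbitWitness (W : DeligneGoncharov2005.MotivicOrbitWitness) :
    motivicMZV_nonempty :=
  ⟨W.toMotivicMZV⟩

/-- **The single remaining input of the formalization of [Brown2012]**: the named fact
`Brown2012.motivicMZV_nonempty` follows from `Nonempty DeligneGoncharov2005.MotivicOrbitWitness`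
(the theorem of [DG05, §§1–2, §5] with [Borel1974], module docstring).
[cite: BrownMTM2012, §2.1, §2.3 (2.12), §2.5; DeligneGoncharov2005, Prop. 2.2–2.3, 5.11–5.12,
5.16, 5.19–5.20, Thm. 5.24] -/
theorem motivicMZV_nonempty_of_nonempty_motivicOrbitWitness
    (h : Nonempty DeligneGoncharov2005.MotivicOrbitWitness) : motivicMZV_nonempty :=
  h.elim motivicMZV_nonempty_of_motivicOrbitWitness

end Brown2012

/-- **Hoffman's theorem (Brown 2012, Thm 1.1) from a Deligne–Goncharov witness**: the S24 named fact
`hoffmanSpan_eq_mzvSpace`. [cite: BrownMTM2012, Theorem 1.1 and §7.2] -/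
theorem hoffmanSpan_eq_mzvSpace_of_motivicOrbitWitness
    (h : Nonempty DeligneGoncharov2005.MotivicOrbitWitness) : hoffmanSpan_eq_mzvSpace :=
  hoffmanSpan_eq_mzvSpace_of_motivicMZV_nonempty
    (Brown2012.motivicMZV_nonempty_of_nonempty_motivicOrbitWitness h)

/-- **`dim 𝒵_N ≤ d_N` (Terasoma; Deligne–Goncharov) from a Deligne–Goncharov witness**: the S24
named fact `finrank_mzvSpace_le_zagierDim`.
[cite: BrownMTM2012, (7.2) and Corollary 7.5; DeligneGoncharov2005, Cor. 5.25] -/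
theorem finrank_mzvSpace_le_zagierDim_of_motivicOrbitWitness
    (h : Nonempty DeligneGoncharov2005.MotivicOrbitWitness) : finrank_mzvSpace_le_zagierDim :=
  finrank_mzvSpace_le_zagierDim_of_motivicMZV_nonempty
    (Brown2012.motivicMZV_nonempty_of_nonempty_motivicOrbitWitness h)

end Literature.NumberTheory.Transcendental
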